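import Literature.Computability.Complexity.ExtMonotoneGates
import Literature.Computability.Complexity.CliqueTestGraphs
import Literature.Computability.Complexity.MonotoneSwitching
import Summits.PneNP.PneNP.Theorems.ConvexRankGatesCliqueExtLowerBoundRealInline
import Mathlib

/-!
# Wideness is free for CONV gates: padding an SDP presentation
(stub `convCnfAll_of_convWideCnf` of the line `width-threshold-certificate-sparsity`, reshape r8 of lead c12;
crux `ConvexRankGates.CliqueExtLowerBound`, stmt-PneNP-10682)

The r7 CONV leaf only speaks about CONV gates PRESENTED with more than `⌊m^{1/16}⌋₊` rows and a psd
variable of dimension `> c+1`; the r8 CONV leaf speaks about EVERY CONV gate of width `≤ m^c`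
(`IsConvGate (m^c) φ`). The side condition is idle: a presentation `(p, q, A, b, B)` of `φ` with
`p + q ≤ m^c` is padded to `p' = p + (⌊m^{1/16}⌋₊ + 1)` rows (the new rows read `tr(0 · Y) ≤ 0 + ∑ 0`,
always satisfied) and psd dimension `q' = q + (c + 3)` (every old `Aᵢ` is extended by a zero block,
`fromBlocks Aᵢ 0 0 0`, reindexed along `finSumFinEquiv`). Feasibility is unchanged: a psd `Y'` of size
`q'` restricts to its psd top-left block `Y` with `tr(A'ᵢ Y') = tr(Aᵢ Y)`, and a psd `Y` of size `q`
extends by zeros to a psd `Y'` with the same traces (`sdp_pad_iff`). So the SAME gate `φ`, with the SAME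
children, satisfies the hypothesis of the r7 leaf at level `c + 1` once
`m^c + ⌊m^{1/16}⌋₊ + 1 + c + 3 ≤ m^{c+1}` (`eventually_conv_pad_numerics`), and the error factor
`1/(8 m^{c+2})` delivered there is below the factor `1/(8 m^{c+1})` asked at level `c`
(`convCnfAll_of_convWideCnf`). Everything here is bookkeeping. [folklore]
-/

-- summit and problem are both named `PneNP`, so every declaration lives in `Summit.PneNP.PneNP.…`
set_option linter.dupNamespace false

open Literature.Computability.Complexity Filter Finset

namespace Summit.PneNP.PneNP.Theorems.CliqueExtLowerBound.WidthThreshold.ConvPad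

open Summit.PneNP.PneNP.Theorems.CliqueExtLowerBound.WidthThreshold.RealInline (floor_pow_sixteen_le)

/-! ## §1 Block bookkeeping -/

/-- The trace is invariant under simultaneous reindexing of rows and columns along an equivalence.
[folklore] -/
theorem trace_submatrix_equiv {m n : Type*} [Fintype m] [Fintype n] (M : Matrix n n ℝ) (e : m ≃ n) :
    (M.submatrix e e).trace = M.trace := by
  simp only [Matrix.trace, Matrix.diag_apply, Matrix.submatrix_apply]
  exact e.sum_comp (fun i => M i i)

/-- `tr (fromBlocks A 0 0 0 · Y)` only reads the top-left block of `Y`: it is `tr (A · Y₁₁)`. [folklore] -/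
theorem trace_fromBlocks_zero_mul {m n : Type*} [Fintype m] [Fintype n] (A : Matrix m m ℝ)
    (Y : Matrix (m ⊕ n) (m ⊕ n) ℝ) :
    (Matrix.fromBlocks A 0 0 (0 : Matrix n n ℝ) * Y).trace = (A * Y.toBlocks₁₁).trace := by
  simp [Matrix.trace, Matrix.mul_apply, Fintype.sum_sum_type, Matrix.toBlocks₁₁]

/-- The extension of a psd matrix by zero blocks, `fromBlocks Y 0 0 0`, is psd (its quadratic form is
the quadratic form of `Y` on the first block of coordinates). [folklore] -/
theorem posSemidef_fromBlocks_zero {m n : Type*} [Fintype m] [Fintype n] {Y : Matrix m m ℝ}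
    (hY : Y.PosSemidef) : (Matrix.fromBlocks Y 0 0 (0 : Matrix n n ℝ)).PosSemidef := by
  refine Matrix.PosSemidef.of_dotProduct_mulVec_nonneg
    (Matrix.IsHermitian.fromBlocks hY.1 (by simp) Matrix.isHermitian_zero) fun x => ?_
  have hx : dotProduct (star x) ((Matrix.fromBlocks Y 0 0 (0 : Matrix n n ℝ)).mulVec x) =
      dotProduct (star fun a => x (Sum.inl a)) (Y.mulVec fun a => x (Sum.inl a)) := by
    simp [dotProduct, Matrix.mulVec, Fintype.sum_sum_type]
  rw [hx]
  exact hY.dotProduct_mulVec_nonneg _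

/-- **Padding an SDP presentation does not change feasibility.** Rows `i < p` keep their data, with `Aᵢ`
extended by a zero block to dimension `q + k₂` (reindexed along `finSumFinEquiv`); the `k₁` new rows
carry `A = 0`, `b = 0`, `B = 0`. A feasible psd `Y'` of size `q + k₂` restricts to its top-left block;
a feasible psd `Y` of size `q` extends by zeros. [folklore] -/
theorem sdp_pad_iff {n p q k₁ k₂ : ℕ} (A : Fin p → Matrix (Fin q) (Fin q) ℝ) (b : Fin p → ℝ)
    (B : Fin p → Fin n → ℝ) (v : Fin n → Bool) :
    (∃ Y' : Matrix (Fin (q + k₂)) (Fin (q + k₂)) ℝ, Y'.PosSemidef ∧ ∀ i : Fin (p + k₁),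
      (Fin.addCases (motive := fun _ => Matrix (Fin (q + k₂)) (Fin (q + k₂)) ℝ)
          (fun i => (Matrix.fromBlocks (A i) 0 0 (0 : Matrix (Fin k₂) (Fin k₂) ℝ)).submatrix
            finSumFinEquiv.symm finSumFinEquiv.symm) (fun _ => 0) i * Y').trace ≤
        Fin.addCases (motive := fun _ => ℝ) b (fun _ => 0) i +
          ∑ j, Fin.addCases (motive := fun _ => Fin n → ℝ) B (fun _ => fun _ => 0) i j *
            (if v j then (1 : ℝ) else 0)) ↔
    ∃ Y : Matrix (Fin q) (Fin q) ℝ, Y.PosSemidef ∧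
      ∀ i, (A i * Y).trace ≤ b i + ∑ j, B i j * (if v j then (1 : ℝ) else 0) := by
  set e : Fin q ⊕ Fin k₂ ≃ Fin (q + k₂) := finSumFinEquiv with he
  -- transport of `tr (M' · Y')` along `e`
  have hkey : ∀ (M : Matrix (Fin q ⊕ Fin k₂) (Fin q ⊕ Fin k₂) ℝ)
      (Y' : Matrix (Fin (q + k₂)) (Fin (q + k₂)) ℝ),
      (M.submatrix e.symm e.symm * Y').trace = (M * Y'.submatrix e e).trace := fun M Y' => by
    have hY' : Y' = (Y'.submatrix e e).submatrix e.symm e.symm := by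
      rw [Matrix.submatrix_submatrix, Equiv.self_comp_symm, Matrix.submatrix_id_id]
    conv_lhs => rw [hY', Matrix.submatrix_mul_equiv]
    exact trace_submatrix_equiv _ e.symm
  constructor
  · rintro ⟨Y', hY', hrows⟩
    refine ⟨(Y'.submatrix e e).toBlocks₁₁, (hY'.submatrix e).submatrix Sum.inl, fun i => ?_⟩
    have h := hrows (Fin.castAdd k₁ i)
    simp only [Fin.addCases_left] at h
    rwa [hkey, trace_fromBlocks_zero_mul] at h
  · rintro ⟨Y, hY, hrows⟩
    refine ⟨(Matrix.fromBlocks Y 0 0 (0 : Matrix (Fin k₂) (Fin k₂) ℝ)).submatrix e.symm e.symm,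
      (Matrix.posSemidef_submatrix_equiv e.symm).2 (posSemidef_fromBlocks_zero hY), fun i => ?_⟩
    induction i using Fin.addCases with
    | left i =>
      simp only [Fin.addCases_left]
      rw [Matrix.submatrix_mul_equiv, trace_submatrix_equiv, trace_fromBlocks_zero_mul,
        Matrix.toBlocks_fromBlocks₁₁]
      exact hrows i
    | right i =>
      simp only [Fin.addCases_right]
      simp

/-! ## §2 Numerics of the level shift `c ↦ c + 1` -/

/-- For large `m`: the padded width fits, `m^c + (⌊m^{1/16}⌋₊ + 1) + (c + 3) ≤ m^{c+1}`; the children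
budget grows, `m^{c+3} ≤ m^{c+4}`; and the error factor shrinks, `1/(8m^{c+2}) ≤ 1/(8m^{c+1})`. [folklore] -/
theorem eventually_conv_pad_numerics (c : ℕ) : ∀ᶠ m : ℕ in atTop,
    m ^ c + (⌊(m : ℝ) ^ (1 / 16 : ℝ)⌋₊ + 1) + (c + 3) ≤ m ^ (c + 1) ∧
    m ^ (c + 3) ≤ m ^ (c + 1 + 3) ∧
    1 / (8 * (m : ℝ) ^ (c + 1 + 1)) ≤ 1 / (8 * (m : ℝ) ^ (c + 1)) := by
  filter_upwards [eventually_ge_atTop (2 * c + 12)] with m hm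
  set T := ⌊(m : ℝ) ^ (1 / 16 : ℝ)⌋₊ with hT
  have hT16 : T ^ 16 ≤ m := floor_pow_sixteen_le m
  have h2T : 2 * T ≤ m := by
    rcases Nat.lt_or_ge T 2 with h | h
    · omega
    · calc 2 * T ≤ T * T := Nat.mul_le_mul_right T h
        _ = T ^ 2 := (sq T).symm
        _ ≤ T ^ 16 := Nat.pow_le_pow_right (by omega) (by norm_num)
        _ ≤ m := hT16
  have hm1 : 1 ≤ m := by omega
  have hmc : 1 ≤ m ^ c := Nat.one_le_pow _ _ hm1
  refine ⟨?_, Nat.pow_le_pow_right hm1 (by omega), ?_⟩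
  · have h1 : m ^ (c + 1) = m ^ c * (m - 1) + m ^ c := by
      rw [pow_succ, ← Nat.mul_succ, Nat.succ_eq_add_one, Nat.sub_add_cancel hm1]
    have h2 : m - 1 ≤ m ^ c * (m - 1) := Nat.le_mul_of_pos_left _ hmc
    omega
  · have hm0 : (1 : ℝ) ≤ m := by exact_mod_cast hm1
    refine one_div_le_one_div_of_le (by positivity) ?_
    exact mul_le_mul_of_nonneg_left (pow_le_pow_right₀ hm0 (by omega)) (by norm_num)

/-! ## §3 The r7 CONV leaf (all levels) implies the r8 CONV leaf (all levels) -/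

open Classical in
/-- **Wideness is free (CONV)**: the r7 CONV leaf text (CONV gates presented with `> ⌊m^{1/16}⌋₊` rows and
psd dimension `> c + 1`, all levels `c`) implies the r8 CONV leaf text (every CONV gate of width `≤ m^c`,
all levels `c`). Pad a presentation `(p, q, A, b, B)`, `p + q ≤ m^c`, of `φ` to `p + (⌊m^{1/16}⌋₊ + 1)`
rows (new rows `0 ≤ 0`) and psd dimension `q + (c + 3)` (zero blocks; `sdp_pad_iff`): the same `φ` with
the same children satisfies the hypothesis of the r7 leaf at level `c + 1`
(`eventually_conv_pad_numerics`), whose error factor `1/(8m^{c+2})` is below `1/(8m^{c+1})`. [folklore] -/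
theorem convCnfAll_of_convWideCnf :
    (∀ c : ℕ, ∃ r₀ s₀ : ℕ, 2 ≤ r₀ ∧ 2 ≤ s₀ ∧ ∀ r s : ℕ, r₀ ≤ r → s₀ ≤ s →
    ∀ᶠ m : ℕ in atTop, ∀ φ : GateFn,
      (∃ p q : ℕ, p + q ≤ m ^ c ∧ ⌊(m : ℝ) ^ (1 / 16 : ℝ)⌋₊ < p ∧ c + 1 < q ∧
        ∃ (A : Fin p → Matrix (Fin q) (Fin q) ℝ) (b : Fin p → ℝ)
        (B : Fin p → Fin φ.1 → ℝ), (∀ i j, 0 ≤ B i j) ∧ ∀ v : Fin φ.1 → Bool, φ.2 v = true ↔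
          ∃ Y : Matrix (Fin q) (Fin q) ℝ, Y.PosSemidef ∧
            ∀ i, (A i * Y).trace ≤ b i + ∑ j, B i j * (if v j then (1 : ℝ) else 0)) →
      ∀ C : Fin φ.1 → Finset (Finset ((⊤ : SimpleGraph (Fin m)).edgeSet)),
        #(univ.image C) ≤ m ^ (c + 3) → (∀ j, ∀ S ∈ C j, #S ≤ s - 1) →
        ∃ dnf cnf : Finset (Finset ((⊤ : SimpleGraph (Fin m)).edgeSet)),
          (∀ R ∈ dnf, #R ≤ r - 1) ∧ (∀ S ∈ cnf, #S ≤ s - 1) ∧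
          (∀ x, EvalDNF dnf x → EvalCNF cnf x) ∧
          (#((posGraphs m ⌈(m : ℝ) ^ (1 / 4 : ℝ)⌉₊).filter
              (fun x => φ.2 (fun j => decide (EvalCNF (C j) x)) = true ∧ ¬ EvalDNF dnf x)) : ℝ)
            ≤ (1 / (8 * (m : ℝ) ^ (c + 1))) * #(posGraphs m ⌈(m : ℝ) ^ (1 / 4 : ℝ)⌉₊) ∧
          (#((((powersetCard (Fintype.card ((⊤ : SimpleGraph (Fin m)).edgeSet) / ⌊(m : ℝ) ^ (1 / 8 : ℝ)⌋₊)
          (univ : Finset ((⊤ : SimpleGraph (Fin m)).edgeSet))).image (fun M => fun e => decide (e ∉ M)))).filter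
              (fun x => EvalCNF cnf x ∧ φ.2 (fun j => decide (EvalCNF (C j) x)) = false)) : ℝ)
            ≤ (1 / (8 * (m : ℝ) ^ (c + 1))) *
              #(((powersetCard (Fintype.card ((⊤ : SimpleGraph (Fin m)).edgeSet) / ⌊(m : ℝ) ^ (1 / 8 : ℝ)⌋₊)
          (univ : Finset ((⊤ : SimpleGraph (Fin m)).edgeSet))).image (fun M => fun e => decide (e ∉ M))))) →
    (∀ c : ℕ, ∃ r₀ s₀ : ℕ, 2 ≤ r₀ ∧ 2 ≤ s₀ ∧ ∀ r s : ℕ, r₀ ≤ r → s₀ ≤ s →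
    ∀ᶠ m : ℕ in atTop, ∀ φ : GateFn, IsConvGate (m ^ c) φ →
      ∀ C : Fin φ.1 → Finset (Finset ((⊤ : SimpleGraph (Fin m)).edgeSet)),
        #(univ.image C) ≤ m ^ (c + 3) → (∀ j, ∀ S ∈ C j, #S ≤ s - 1) →
        ∃ dnf cnf : Finset (Finset ((⊤ : SimpleGraph (Fin m)).edgeSet)),
          (∀ R ∈ dnf, #R ≤ r - 1) ∧ (∀ S ∈ cnf, #S ≤ s - 1) ∧
          (∀ x, EvalDNF dnf x → EvalCNF cnf x) ∧
          (#((posGraphs m ⌈(m : ℝ) ^ (1 / 4 : ℝ)⌉₊).filter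
              (fun x => φ.2 (fun j => decide (EvalCNF (C j) x)) = true ∧ ¬ EvalDNF dnf x)) : ℝ)
            ≤ (1 / (8 * (m : ℝ) ^ (c + 1))) * #(posGraphs m ⌈(m : ℝ) ^ (1 / 4 : ℝ)⌉₊) ∧
          (#((((powersetCard (Fintype.card ((⊤ : SimpleGraph (Fin m)).edgeSet) / ⌊(m : ℝ) ^ (1 / 8 : ℝ)⌋₊)
          (univ : Finset ((⊤ : SimpleGraph (Fin m)).edgeSet))).image (fun M => fun e => decide (e ∉ M)))).filter
              (fun x => EvalCNF cnf x ∧ φ.2 (fun j => decide (EvalCNF (C j) x)) = false)) : ℝ)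
            ≤ (1 / (8 * (m : ℝ) ^ (c + 1))) *
              #(((powersetCard (Fintype.card ((⊤ : SimpleGraph (Fin m)).edgeSet) / ⌊(m : ℝ) ^ (1 / 8 : ℝ)⌋₊)
          (univ : Finset ((⊤ : SimpleGraph (Fin m)).edgeSet))).image (fun M => fun e => decide (e ∉ M))))) := by
  intro h c
  obtain ⟨r₀, s₀, hr₀, hs₀, H⟩ := h (c + 1)
  refine ⟨r₀, s₀, hr₀, hs₀, fun r s hr hs => ?_⟩
  filter_upwards [H r s hr hs, eventually_conv_pad_numerics c] with m hm hnum
  intro φ hφ C hC hCs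
  obtain ⟨hnum1, hnum2, hnum3⟩ := hnum
  obtain ⟨p, q, hpq, A, b, B, hB, hiff⟩ := hφ
  -- the padded presentation: `p + (T + 1)` rows, psd dimension `q + (c + 3)`
  have hB' : ∀ (i : Fin (p + (⌊(m : ℝ) ^ (1 / 16 : ℝ)⌋₊ + 1))) (j : Fin φ.1),
      0 ≤ Fin.addCases (motive := fun _ => Fin φ.1 → ℝ) B (fun _ => fun _ => 0) i j := by
    intro i j
    induction i using Fin.addCases with
    | left i => simp only [Fin.addCases_left]; exact hB i j
    | right i => simp only [Fin.addCases_right]; exact le_rfl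
  obtain ⟨dnf, cnf, h1, h2, h3, h4, h5⟩ := hm φ
    ⟨p + (⌊(m : ℝ) ^ (1 / 16 : ℝ)⌋₊ + 1), q + (c + 3), by omega, by omega, by omega,
      fun i => Fin.addCases (motive := fun _ => Matrix (Fin (q + (c + 3))) (Fin (q + (c + 3))) ℝ)
        (fun i => (Matrix.fromBlocks (A i) 0 0 (0 : Matrix (Fin (c + 3)) (Fin (c + 3)) ℝ)).submatrix
          finSumFinEquiv.symm finSumFinEquiv.symm) (fun _ => 0) i,
      fun i => Fin.addCases (motive := fun _ => ℝ) b (fun _ => 0) i,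
      fun i j => Fin.addCases (motive := fun _ => Fin φ.1 → ℝ) B (fun _ => fun _ => 0) i j,
      hB', fun v => (hiff v).trans (sdp_pad_iff A b B v).symm⟩ C (hC.trans hnum2) hCs
  exact ⟨dnf, cnf, h1, h2, h3, h4.trans (mul_le_mul_of_nonneg_right hnum3 (Nat.cast_nonneg _)),
    h5.trans (mul_le_mul_of_nonneg_right hnum3 (Nat.cast_nonneg _))⟩

end Summit.PneNP.PneNP.Theorems.CliqueExtLowerBound.WidthThreshold.ConvPad
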